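import Literature.NumberTheory.GaloisCohomology.Howard2004.TransportUnramified
import Literature.NumberTheory.GaloisRepresentations.GaloisH1MapBijectiveUnramified
import HarnessLib

/-!
# Howard 2004, §1.5: the local `τ` at an inert prime preserves the unramified (finite) condition
# `H¹_f(K_λ, T̄) = H¹_ur(K_λ, T̄)` (theorems only)

Topic `NumberTheory/GaloisCohomology/Howard2004`. THEOREMS ONLY: no definition, no named fact, no
instance, no notation, no `sorry`. Cell `pub/bsd-print-x9`, print leaf G87
`Literature.NumberTheory.GaloisCohomology.Howard2004.thm161_dvrKolyvaginBound`; seat `bsd-line-x10b-p1-w5`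
g7 ([EIG-LOC] step 2 of the Lemma 1.5.3 chain, sequel to `InertLocalTauProofs`: `τ_q`-stability of the finite condition, so that the
finite component of a local `ε`-eigenvector is again an `ε`-eigenvector).

SOURCE. B. Howard, Compositio Math. **140** (2004) = arXiv:1202.6340, Lemma 1.5.3 proof (p. 10
L12–16): «the action of complex conjugation splits `H¹_f(K_ℓ, T̄)` and `H¹_s(K_ℓ, T̄)` each into
one-dimensional eigenspaces» — in particular `τ` ACTS on `H¹_f(K_ℓ, T̄)`; with §1.1 (p. 5 L52–53:
`H¹_f = H¹_ur` at `v ∤ p` for `T` unramified) and §1.3 (p. 7 L44–48: the transport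
`H¹(K_v̄, T) ≅ H¹(K_v, Tw T)`).

WHAT IS PROVED (`τ_q x := θ_* (transport_q (h.symm ▸ x))` at an inert `q`, `h : cd.σ • q = q`, as in
`InertLocalTauProofs`):
* §1 `ResidualTau.thetaH1_eq_map` (`θ_*` on `H¹(K_v, ·)` is `galoisCohomology.map` of the intertwining map `θ`),
  **`ResidualTau.thetaH1_mem_unramifiedSubgroup`** (`θ_*` carries `H¹_ur(K_v, Tw T̄)` into `H¹_ur(K_v, T̄)`, tree
  `galoisCohomology.map_unramifiedSubgroup_le`), `cast_mem_unramifiedSubgroup_iff` (the place cast preserves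
  `H¹_ur`).
* §2 **`ResidualTau.thetaH1_transportH1_cast_mem_unramifiedSubgroup`**: if the local transport `φ_q` of the
  conjugation datum respects inertia (`g ∈ I_{K_q} → φ_q g ∈ I_{K_{σq}}`; a theorem for the canonical datum,
  `ConjugationDatum.phi_mem_absInertia_iff`), then `x ∈ H¹_ur(K_q, T̄) ⟹ τ_q x ∈ H¹_ur(K_q, T̄)`.

NOT HERE: the transverse condition, `τ_q² = 1`, the eigenlines; `thm161_dvrKolyvaginBound` is NOT
proved; no summit statement is proved; the Birch–Swinnerton-Dyer conjecture is not proved by any of this.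
References: [Howard2004HeegnerKolyvagin] §1.1, §1.3, Lemma 1.5.3; [MilneADT2006] I §2 (unramified cohomology).
-/

set_option autoImplicit false

noncomputable section

open Function NumberField IsDedekindDomain Field
open scoped NumberField ContRepresentation

namespace Literature.NumberTheory.GaloisCohomology.Howard2004

open Literature.NumberTheory.GaloisRepresentations
open Literature.NumberTheory.GaloisRepresentations.DiscreteGaloisModule
open Literature.NumberTheory.EllipticCurves

variable {K : Type} [Field K] [NumberField K] {Nbar : Type} [AddCommGroup Nbar]
  [TopologicalSpace Nbar] [DiscreteTopology Nbar] {R : Type} [CommRing R] [Module R Nbar]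
  {cd : ConjugationDatum K} {ρbar : DiscreteGaloisModule K Nbar}

/-! ## §1 `θ_*` and the place cast preserve `H¹_ur` -/

namespace ResidualTau

/-- `θ_*` on `H¹(K_v, ·)` is `galoisCohomology.map` of `θ` read as a continuous intertwining map
`Tw(T̄)|_v → T̄|_v` (definitionally). [cite: Howard2004HeegnerKolyvagin, §1.3 H.5(a) (arXiv p. 7 L93–97)] -/
theorem thetaH1_eq_map (A : ResidualTau (R := R) cd ρbar) (v : HeightOneSpectrum (𝓞 K))
    (y : galoisCohomology ((cd.twist ρbar).toLocal (Sum.inr v)) 1) :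
    A.thetaH1 (Sum.inr v) y = galoisCohomology.map
      (ρ := GaloisRep.toLocal v (cd.twist ρbar)) (ρ' := GaloisRep.toLocal v ρbar)
      ({ toContinuousLinearMap := ⟨A.θ.toAddMonoidHom.toIntLinearMap, continuous_of_discreteTopology⟩
         isIntertwining' := fun g => ContinuousLinearMap.ext fun x =>
           A.compat (absGaloisRestrict K (v.adicCompletion K) g) x } :
        (GaloisRep.toLocal v (cd.twist ρbar)).toContRepresentation →ⁱL
          (GaloisRep.toLocal v ρbar).toContRepresentation) 1 y :=
  rfl

/-- **`θ_*` carries `H¹_ur(K_v, Tw T̄)` into `H¹_ur(K_v, T̄)`** (`θ` is an equivariant module map; tree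
`galoisCohomology.map_unramifiedSubgroup_le`). [cite: Howard2004HeegnerKolyvagin, Lemma 1.5.3 proof (arXiv p. 10 L12–16: «complex conjugation splits `H¹_f(K_ℓ, T̄)` …») and §1.1 (p. 5 L52–53)] [cite: MilneADT2006, Ch. I §2 (unramified cohomology)] -/
theorem thetaH1_mem_unramifiedSubgroup (A : ResidualTau (R := R) cd ρbar) (v : HeightOneSpectrum (𝓞 K))
    {y : galoisCohomology ((cd.twist ρbar).toLocal (Sum.inr v)) 1}
    (hy : y ∈ unramifiedSubgroup (GaloisRep.toLocal v (cd.twist ρbar)) 1) :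
    A.thetaH1 (Sum.inr v) y ∈ unramifiedSubgroup (GaloisRep.toLocal v ρbar) 1 := by
  rw [A.thetaH1_eq_map]
  exact galoisCohomology.map_unramifiedSubgroup_le _ ⟨y, hy, rfl⟩

end ResidualTau

/-- The place cast along `v = w` preserves `H¹_ur`. [cite: Howard2004HeegnerKolyvagin, §1.3 (arXiv p. 7 L44–48, read at `λ̄ = λ`)] -/
theorem cast_mem_unramifiedSubgroup_iff {M : Type} [AddCommGroup M] [TopologicalSpace M]
    [DiscreteTopology M] (ρ : DiscreteGaloisModule K M) {v w : HeightOneSpectrum (𝓞 K)} (h : v = w)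
    (x : galoisCohomology (ρ.toLocal (Sum.inr v)) 1) :
    (h ▸ x : galoisCohomology (ρ.toLocal (Sum.inr w)) 1) ∈ unramifiedSubgroup (GaloisRep.toLocal w ρ) 1 ↔
      x ∈ unramifiedSubgroup (GaloisRep.toLocal v ρ) 1 := by
  subst h
  exact Iff.rfl

/-! ## §2 `τ_q` preserves `H¹_ur(K_q, T̄)` -/

namespace ResidualTau

/-- **`τ_q` preserves the unramified (finite) condition at an inert prime**: for `h : σ • q = q` and a
conjugation datum whose local transport respects inertia at `q`,
`x ∈ H¹_ur(K_q, T̄) ⟹ θ_* (transport_q (h.symm ▸ x)) ∈ H¹_ur(K_q, T̄)` — «complex conjugation acts on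
`H¹_f(K_ℓ, T̄)`». [cite: Howard2004HeegnerKolyvagin, Lemma 1.5.3 proof (arXiv p. 10 L12–16) with §1.3 (p. 7 L44–48)] [cite: MilneADT2006, Ch. I §2] -/
theorem thetaH1_transportH1_cast_mem_unramifiedSubgroup (A : ResidualTau (R := R) cd ρbar)
    {q : HeightOneSpectrum (𝓞 K)} (h : cd.σ • q = q)
    (hI : ∀ g ∈ absInertia (q.adicCompletion K), cd.φ q g ∈ absInertia ((cd.σ • q).adicCompletion K))
    {x : galoisCohomology (ρbar.toLocal (Sum.inr q)) 1}
    (hx : x ∈ unramifiedSubgroup (GaloisRep.toLocal q ρbar) 1) :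
    A.thetaH1 (Sum.inr q) (cd.transportH1 ρbar q
        (h.symm ▸ x : galoisCohomology (ρbar.toLocal (Sum.inr (cd.σ • q))) 1)) ∈
      unramifiedSubgroup (GaloisRep.toLocal q ρbar) 1 := by
  refine A.thetaH1_mem_unramifiedSubgroup q (cd.map_transportH1_unramifiedSubgroup_le ρbar q hI
    ⟨_, ?_, rfl⟩)
  exact (cast_mem_unramifiedSubgroup_iff ρbar h.symm x).mpr hx

end ResidualTau

end Literature.NumberTheory.GaloisCohomology.Howard2004
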